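import Literature.Barriers.PneNP.MonotoneGap
import Literature.Computability.Complexity.PerfectMatchingCircuitCorrect
import HarnessLib

/-!
# Discharge of `perfectMatching_polysize` (Jukna 2012, §9.11)

`Literature.Barriers.PneNP.perfectMatching_polysize` (vendored in `MonotoneGap.lean` from
Jukna 2012, §9.11, PDF p. 291: the perfect matching function `f_m` "can be computed by a
non-monotone circuit using only `O(m⁵)` gates", via Hopcroft–Karp) is PROVED here in its
vendored polynomial form: for all `m ≥ 38400` there is a circuit over `{∧₂, ∨₂, ¬}` of size
`≤ m⁷` computing `perfectMatchingFn m`. The circuit is the layered augmenting-path program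
`BipMatch.pmFn` (`PerfectMatchingCircuit.lean`: `cktSize_pmFn`, `totalBound_le`;
`PerfectMatchingCircuitCorrect.lean`: `pmFn_eq_true_iff`), turned into a `Circuit` by
`CktSize.toCircuit`.

## References

* [Jukna2012] S. Jukna, *Boolean Function Complexity* (2012), §9.11 (PDF p. 291).
* [HopcroftKarp1973] J. E. Hopcroft, R. M. Karp, SIAM J. Comput. 2 (1973) 225–231.
* [KorteVygen2018] B. Korte, J. Vygen, *Combinatorial Optimization* (2018), Thm. 10.5.
-/

namespace Literature.Barriers.PneNP

open Literature.Computability.Complexity Literature.Computability.Complexity.BipMatch Filter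

/-- **Discharge of `perfectMatching_polysize`**: the perfect matching function of `K_{m,m}` has
De Morgan circuits of size `≤ m ^ 7` for all `m ≥ 38400` (Hopcroft–Karp 1973 / Kuhn's
augmenting-path algorithm, realised directly as a circuit). [cite: Jukna2012, §9.11 (PDF p. 291)] -/
theorem perfectMatching_polysize_holds : perfectMatching_polysize := by
  refine ⟨7, ?_⟩
  filter_upwards [eventually_ge_atTop (600 * 2 ^ 6)] with m hm
  have hm1 : 0 < m := by omega
  obtain ⟨C, hB, hs, hev⟩ := (cktSize_pmFn (m := m) (⟨0, hm1⟩, ⟨0, hm1⟩)).toCircuit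
  refine ⟨C, hB, fun x => ?_, hs.trans ((totalBound_le m).trans ?_)⟩
  · apply Bool.eq_iff_iff.2
    rw [hev, pmFn_eq_true_iff, perfectMatchingFn_eq_true_iff]
    rfl
  · have h1 : m + 1 ≤ 2 * m := by omega
    have h2 : (m + 1) ^ 6 ≤ (2 * m) ^ 6 := Nat.pow_le_pow_left h1 6
    calc 600 * (m + 1) ^ 6 ≤ 600 * (2 * m) ^ 6 := Nat.mul_le_mul_left _ h2
      _ = 38400 * m ^ 6 := by ring
      _ ≤ m * m ^ 6 := Nat.mul_le_mul_right _ (by omega)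
      _ = m ^ 7 := by ring

end Literature.Barriers.PneNP
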